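import Literature.NumberTheory.DiophantineGeometry.BcgpSwitchExistsModularAbelianSurface
import Literature.NumberTheory.DiophantineGeometry.GenusTwoTwoTorsionS5b
import Literature.NumberTheory.GaloisRepresentations.OrdinaryPDistinguished
import HarnessLib

/-!
# Boxer–Calegari–Gee–Pilloni 2025, Lemma 9.4.2 (2)(a)–(d): the `2`–`3` switching surface exists

Topic `Literature/NumberTheory/DiophantineGeometry`. ONE named fact (D-0014), no proof, no new
definition: Lemma 9.4.2 (2), items (a)–(d), of G. Boxer, F. Calegari, T. Gee, V. Pilloni,
*Modularity theorems for abelian surfaces* (arXiv:2502.20645, p. 135) — the existence of the genus-2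
Jacobian `B/ℚ` through which the `2`–`3` switch of the proof of their Thm. 9.5.2 runs — in the
tree's vocabulary. The body is VERBATIM the hypothesis binder `h₁` of the accepted reduction
`Literature.NumberTheory.DiophantineGeometry.bcgp_switch_exists_modular_abelianSurface_of_lemma942abcd_of_theorem832`
(`BcgpSwitchExistsModularAbelianSurfaceProofs.lean`, Part 11), vendored by the librarian (sweep g26,
vend-from-binder, promote event 3449172) because the provefact seat may not mint named facts
(`lint.fact-fanout`). First consumer: that reduction — with the sibling fact
`bcgp_residuallyA5b_modular_abelianSurface` (`BcgpResiduallyA5bModular.lean`, Thm. 8.3.2) it yields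
`bcgp_switch_exists_modular_abelianSurface` in one line.

## Source and reading

Lemma 9.4.2, verbatim: "Suppose that `ρ̄ : G_ℚ → GSp₄(𝔽₃)` has similitude `ε̄⁻¹`, that
`ρ̄^∨|_{G_{ℚ₃}}` is ordinary and finite flat, and that `ρ̄|_{G_{ℚ₂}}` is unramified. (1) The
following conditions are equivalent: (a) The image of `ρ̄(Frob₂)` in `PGSp₄(𝔽₃) ∖ PSp₄(𝔽₃)` is not
conjugate to `4C` or `12C` …; (b) … (2) Assume that the equivalent conditions in (1) hold. Then
there exists a genus two curve `X/ℚ` with a rational Weierstrass point, with `B = Jac(X)` having the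
following properties: (a) `ρ̄_{B,3} ≅ ρ̄`. (b) `B` has good ordinary or semistable ordinary
reduction at `2`, and is `2`-distinguished. (c) `B` has good ordinary reduction at `3`. (d) The
representation `ρ̄_{B,2} : G_ℚ → GSp₄(𝔽₂)` has image `S₅(b)`, and the image of complex conjugation
has conjugacy class `(**)(**)`. Moreover, `End(B_ℚ̄) = ℤ`."

RENDERING (the seat's clause-by-clause reading, `…Proofs.lean` Part 10 header and §"The hypothesis
`ρ̄_{B,3} ≅ ρ̄` in tree terms"). HYPOTHESES — the same three as the consumer fact
`bcgp_switch_exists_modular_abelianSurface` (whose docstring records the translation): similitude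
`ε̄⁻¹` (`IsSymplecticWithMultiplierFun` with the inverse mod-`3` cyclotomic character);
"`ρ̄^∨|_{G_{ℚ₃}}` ordinary and finite flat" as the block-upper-triangular frame at `v ∣ 3` (inertia
trivial on the rank-2 sub, `ε̄⁻¹` on the rank-2 quotient, Cor. 9.3.5) plus peu ramifié
(`ModPGaloisRep.IsPeuRamifie`, Serre 1987 §2.4/§2.8); unramified at `2` with condition (1)(a) as
`charpoly ρ̄(Frob₂) ≠ (X² ± X + 2)²` (Thm. 9.5.2 (2), Lemma 9.1.3). CONCLUSION — an abelian variety
`B/ℚ` of dimension `2` (the printed `B = Jac(X)`; the curve and its Weierstrass point are not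
recorded) with: (a) a contragredient additive frame `e₃ : B[3](ℚ̄) ≃ (ℤ/3)⁴`, `e₃(g • P) = ρ̄(g⁻¹)ᵀ
e₃(P)` (§1.8.11: `ρ̄_{B,3}` is the representation on `B[3]^∨`); (b) semistable (possibly good)
reduction at `2` in Grothendieck's Galois form — inertia at `2` acts on every `V_ℓ(B)`, `ℓ ≠ 2`,
with `(ρ_ℓ(τ) − 1)² = 0` (SGA 7 I, Exp. IX, 3.5) — and every framed dual `r₂` of `V₂(B)` ordinary
and `2`-distinguished at `v ∣ 2` (Def. 9.1.2 → Def. 1.8.8;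
`FramedGaloisRep.IsOrdinaryPDistinguishedAt`); (c) good ordinary reduction at `3`
(`HasGoodOrdinaryReductionAt`); (d) an additive frame `e₂` of `B[2](ℚ̄)` in which every `g ∈ G_ℚ`
acts by some `s5bMatrix σ` (the accepted matrices of `S₅(b) ⊂ S₆ ≅ Sp₄(𝔽₂)`, §8.1,
`GenusTwoTwoTorsionS5b.lean`), every `σ ∈ S₅` occurs, and every complex conjugation
(`IsComplexConjugation (algebraMap ℚ ℝ) c`) acts by `s5bMatrix σ` with `σ` of cycle type `(2,2)`.

What is deliberately NOT here: the "Moreover, `End(B_ℚ̄) = ℤ`" (deduced loc. cit. from (d) by Zarhin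
2000; its `ℚ`-rational half `End_ℚ(B) = ℤ · 𝟙`, which is all the consumer uses, is PROVED from (d)
in `…Proofs.lean` Part 11, `AbelianVariety.forall_end_eq_zsmul_id_of_s5bFrame`) — so this fact is
the printed items (2)(a)–(d) only, a consequence of the printed lemma; part (1) (the equivalence (a)
⇔ (b)); the curve `X` itself. The proof (fine moduli spaces `P(ρ̄)`, `𝓜₂ʷ(ρ̄)` and their
rationality, Ekedahl's Hilbert irreducibility, Kisin–Krasner, Serre–Tate lifting; §§9.2–9.4) is a
theory absent from Mathlib and the tree.

## References

* [BoxerCalegariGeePilloni2025] G. Boxer, F. Calegari, T. Gee, V. Pilloni, Modularity theorems for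
  abelian surfaces, arXiv:2502.20645 (2025): Lemma 9.4.2, Cor. 9.3.5, Def. 9.1.2, Def. 1.8.8,
  §1.8.11, §8.1, Lemma 9.1.3, Thm. 9.5.2 (2).
* [GrothendieckSGA7IX] A. Grothendieck, Modèles de Néron et monodromie, SGA 7 I, Exp. IX, LNM 288
  (1972), §3, 3.5.
* [Serre1987] J.-P. Serre, Sur les représentations modulaires de degré 2 de Gal(ℚ̄/ℚ), Duke
  Math. J. 54 (1987), §2.4, §2.8.
-/

namespace Literature.NumberTheory.DiophantineGeometry

open CategoryTheory IsDedekindDomain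
open scoped NumberField Matrix
open Literature.NumberTheory.GaloisRepresentations Literature.NumberTheory.Automorphic
open Literature.AlgebraicGeometry.Motives (AbelianVariety)

/-- **Boxer–Calegari–Gee–Pilloni 2025, Lemma 9.4.2 (2)(a)–(d)** (p. 135; the `2`–`3` switching
surface). For every `ρ̄ : G_ℚ → GL₄(𝔽₃)` (`FramedGaloisRep ℚ (ZMod 3) 4`) with similitude `ε̄⁻¹`,
ordinary-and-peu-ramifié block shape at `v ∣ 3` and unramified at `2` with `charpoly ρ̄(Frob₂) ≠ (X²
± X + 2)²` — the three hypotheses of `bcgp_switch_exists_modular_abelianSurface`, verbatim — there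
is an abelian surface `B/ℚ` (`AbelianVariety ℚ`, `dim B = 2`) with (a) `ρ̄_{B,3} ≅ ρ̄` (a
contragredient frame `e₃` of `B[3](ℚ̄)`), (b) semistable-or-good reduction at `2` in Galois form
(`(ρ_ℓ(τ) − 1)² = 0` for inertia `τ` at `2`, all `ℓ ≠ 2`) with every framed dual of `V₂(B)` ordinary
and `2`-distinguished at `v ∣ 2`, (c) good ordinary reduction at `3`, (d) a frame `e₂` of `B[2](ℚ̄)`
in which `G_ℚ` acts through `S₅(b)` (`s5bMatrix`), onto, complex conjugations acting by double
transpositions. VERBATIM the binder `h₁` of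
`bcgp_switch_exists_modular_abelianSurface_of_lemma942abcd_of_theorem832` (the printed "Moreover" is
omitted, see the module docstring).
Users take `(h : bcgp_switchingSurface_exists)`.
Named fact (D-0014), not proved in the tree.
[cite: BoxerCalegariGeePilloni2025, Lemma 9.4.2 (2)(a)–(d), with Cor. 9.3.5, Def. 9.1.2, Def. 1.8.8, §1.8.11, §8.1]
[cite: GrothendieckSGA7IX, Exp. IX §3, 3.5 (semistable reduction in Galois form)] -/
def bcgp_switchingSurface_exists : Prop :=
  ∀ (ρb : FramedGaloisRep ℚ (ZMod 3) 4),
    ρb.IsSymplecticWithMultiplierFun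
        (fun g => (((modPCyclotomicCharacterZMod ℚ 3 g)⁻¹ : (ZMod 3)ˣ) : ZMod 3)) →
    (∀ v : HeightOneSpectrum (𝓞 ℚ), ((3 : ℕ) : 𝓞 ℚ) ∈ v.asIdeal →
      ModPGaloisRep.IsPeuRamifie (ρb.toLocal v) ∧
      ∃ g : GL (Fin 4) (ZMod 3),
        (∀ (τ : Field.absoluteGaloisGroup (v.adicCompletion ℚ)) (i j : Fin 4),
            2 ≤ (i : ℕ) → (j : ℕ) < 2 → (g * ρb.toLocal v τ * g⁻¹).val i j = 0) ∧
        (∀ τ ∈ absInertia (v.adicCompletion ℚ), ∀ i j : Fin 4, (i : ℕ) < 2 → (j : ℕ) < 2 →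
            (g * ρb.toLocal v τ * g⁻¹).val i j = if i = j then 1 else 0) ∧
        (∀ τ ∈ absInertia (v.adicCompletion ℚ), ∀ i j : Fin 4, 2 ≤ (i : ℕ) → 2 ≤ (j : ℕ) →
            (g * ρb.toLocal v τ * g⁻¹).val i j =
              if i = j then
                (((modPCyclotomicCharacterZMod ℚ 3 (absGaloisRestrict ℚ (v.adicCompletion ℚ) τ))⁻¹ :
                    (ZMod 3)ˣ) : ZMod 3)
              else 0)) →
    (∀ v : HeightOneSpectrum (𝓞 ℚ), ((2 : ℕ) : 𝓞 ℚ) ∈ v.asIdeal →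
      ρb.IsUnramifiedAt v ∧
        ∀ Q : Polynomial (ZMod 3), ρb.HasFrobCharpolyAt v Q →
          Q ≠ (Polynomial.X ^ 2 + Polynomial.X + 2) ^ 2 ∧
            Q ≠ (Polynomial.X ^ 2 - Polynomial.X + 2) ^ 2) →
    ∃ B : AbelianVariety ℚ,
      B.dim = 2 ∧
      (∃ e₃ : B.geomTorsion (3 : ℕ) ≃+ (Fin 4 → ZMod 3),
        ∀ (g : Field.absoluteGaloisGroup ℚ) (P : B.geomTorsion (3 : ℕ)),
          e₃ (g • P) =
            ((ρb g⁻¹ : GL (Fin 4) (ZMod 3)) : Matrix (Fin 4) (Fin 4) (ZMod 3))ᵀ *ᵥ e₃ P) ∧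
      (∀ (ℓ : ℕ) [Fact ℓ.Prime], ℓ ≠ 2 →
        ∀ v : HeightOneSpectrum (𝓞 ℚ), ((2 : ℕ) : 𝓞 ℚ) ∈ v.asIdeal →
          ∀ τ ∈ absInertia (v.adicCompletion ℚ),
            (B.rationalTateRep ℓ (absGaloisRestrict ℚ (v.adicCompletion ℚ) τ) - 1) ^ 2 = 0) ∧
      (∀ (b₂ : Module.Basis (Fin 4) ℚ_[2] (B.rationalTateModule 2))
          (r₂ : FramedGaloisRep ℚ (PadicAlgCl 2) 4),
          (∀ g : Field.absoluteGaloisGroup ℚ,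
            (r₂ g).val =
              ((LinearMap.toMatrix b₂ b₂ (B.rationalTateRep 2 g⁻¹)).map
                (algebraMap ℚ_[2] (PadicAlgCl 2))).transpose) →
          ∀ v : HeightOneSpectrum (𝓞 ℚ), ((2 : ℕ) : 𝓞 ℚ) ∈ v.asIdeal →
            r₂.IsOrdinaryPDistinguishedAt v) ∧
      (∀ v : HeightOneSpectrum (𝓞 ℚ), ((3 : ℕ) : 𝓞 ℚ) ∈ v.asIdeal →
        B.HasGoodOrdinaryReductionAt v) ∧
      (∃ e₂ : B.geomTorsion (2 : ℕ) ≃+ (Fin 4 → ZMod 2),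
        (∀ g : Field.absoluteGaloisGroup ℚ, ∃ σ : Equiv.Perm (Fin 5),
            ∀ P : B.geomTorsion (2 : ℕ), e₂ (g • P) = s5bMatrix σ *ᵥ e₂ P) ∧
        (∀ σ : Equiv.Perm (Fin 5), ∃ g : Field.absoluteGaloisGroup ℚ,
            ∀ P : B.geomTorsion (2 : ℕ), e₂ (g • P) = s5bMatrix σ *ᵥ e₂ P) ∧
        (∀ c : Field.absoluteGaloisGroup ℚ, IsComplexConjugation (algebraMap ℚ ℝ) c →
            ∃ σ : Equiv.Perm (Fin 5), σ.cycleType = {2, 2} ∧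
              ∀ P : B.geomTorsion (2 : ℕ), e₂ (c • P) = s5bMatrix σ *ᵥ e₂ P))

end Literature.NumberTheory.DiophantineGeometry
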